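import Literature.Geometry.Riemannian.GaussBonnet
import Literature.Geometry.Lorentzian.DivergenceTheoremCompactSupport
import Literature.Geometry.Lorentzian.LevelCurveGeodesicCurvature
import Literature.Topology.FourManifolds.ProperMorseFunction
import HarnessLib

/-!
# The weighted Gauss–Bonnet formula: Gauss–Bonnet with boundary, in flux form, on open surfaces

Let `(N, g)` be a Riemannian `2`-manifold modelled on `ℝ²` — Hausdorff, locally compact,
σ-compact, without boundary, **not necessarily compact** — `ρ : N → ℝ` a Morse function and
`η : ℝ → ℝ` smooth such that the weight `η ∘ ρ` has compact support and `η` is locally constant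
near every critical value `ρ(p)`. We PROVE

  `∫_N η(ρ) S dμ = 4π Σ_p (−1)^{ind_p ρ} η(ρ(p)) + 2 ∫_N η'(ρ) (Δρ − Hess ρ(∇ρ, ∇ρ)/|∇ρ|²) dμ`  (★)

(`integral_comp_mul_scalarCurvature_eq_sum_add_integral_deriv`), the sum running over the
finitely many critical points in the support of the weight, `S = 2K` the scalar curvature,
`ind_p ρ` the Morse index. The last integrand is supported where `η'(ρ) ≠ 0`, i.e. away from the
critical points, and there `Δρ − Hess ρ(n, n) = Hess ρ(T, T) = |∇ρ| k` (`n = ∇ρ/|∇ρ|`, `T` a unit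
tangent of the level curve, `k` its geodesic curvature with respect to the normal `−n` pointing
INTO the sublevel set; `LevelCurveGeodesicCurvature.lean`). Thus (★) is the Gauss–Bonnet theorem
for surfaces with boundary,

  `∫_D K dA + ∫_{∂D} κ_N ds = 2π χ(D)`     (Lee 2018, Problem 9-10; Thm. 9.3 for the formula),

applied to the sublevel sets `D_t = {ρ ≤ t}` and integrated against `−η'(t) dt` (coarea): the
Euler characteristic enters through the Morse count `χ(D_t) = Σ_{ρ(p) < t} (−1)^{ind_p}`
(Milnor 1963, Thm. 5.2 and §5), and the boundary term through `∫ η'(ρ) k |∇ρ| dA =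
∫ η'(t) (∫_{ρ = t} k ds) dt`. In this smeared form neither the coarea formula, nor arc length on
level curves, nor a manifold-with-boundary structure is needed, and the identity holds on
non-compact surfaces — the setting of Schoen–Yau 1979, §2, second proof of the Claim `∫_S K ≤ 0`
(pp. 57–63), where the Gauss–Bonnet theorem is applied to the exhaustion `D_σ = {r' ≤ σ}` of the
complete area-minimising surface `S` and `σ` is then CHOSEN in `[σ̄, 2σ̄]` by averaging the
boundary terms ((2.26)–(2.32)) — which is exactly an instance of (★) with `η' ≈ −1/σ̄` on
`[σ̄, 2σ̄]`.

Special cases: `η ≡ 1` on a compact `N` is the Gauss–Bonnet theorem of the tree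
(`GaussBonnet.lean`, `∫ S = 4π χ(N)` after `Σ (−1)^{ind} = χ`); `η = 1` on `(−∞, a]`, `= 0` on
`[b, ∞)` with no critical values in `[a, b]` and `{ρ ≤ b}` compact gives **Gauss–Bonnet for the
regular sublevel set `{ρ ≤ a}` with a collar** (`integral_comp_mul_scalarCurvature_eq_of_sublevel`):
`∫ η(ρ) S dμ = 4π Σ_{ρ(p) < a} (−1)^{ind_p} + 2∫ η'(ρ)(Δρ − Hess ρ(n,n)) dμ`.

## Proof (Poincaré–Hopf route of `GaussBonnet.lean`, weighted)

With `Y = grad ρ` and the normalized acceleration field `X = (∇_Y Y − (div Y) Y)/g(Y,Y)`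
(`div X = S/2` off the zeros of `Y`, `CurvatureAsDivergence.lean`), cut `X` off near the critical
points `p ∈ C` by the transported cutoffs `χ_r = Π_p χ_r^p` (`TransportedCutoff.lean`) and apply the
divergence theorem for COMPACTLY SUPPORTED fields (`DivergenceTheoremCompactSupport.lean`) to
`W = η(ρ) χ_r X`:

  `0 = ∫ η(ρ) χ_r S/2 + Σ_p η(ρ(p)) ∫ dχ_r^p(X) + ∫ χ_r d(η∘ρ)(X)`,

using that `η ∘ ρ` is constant (`= η(ρ(p))`) and `d(η ∘ ρ) = 0` on the small cutoff regions. The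
index fluxes tend to `−2π (−1)^{ind_p}` (`GaussBonnetLocal.abs_integral_mvfderiv_mcutoff_add_le`,
`GaussBonnetGradient.exists_linearization_grad`), the cutoff regions have area `O(r²)`, and
`χ_r d(η∘ρ)(X) = d(η∘ρ)(X)` for small `r`; letting `r → 0` gives (★) with boundary integrand
`d(η∘ρ)(X) = η'(ρ) dρ(X)` (`integral_comp_mul_scalarCurvature_eq`), and
`dρ(X) = Hess ρ(∇ρ,∇ρ)/|∇ρ|² − Δρ` (`mvfderiv_normalizedAcceleration_grad`: `dρ(∇_Y Y) = Hess ρ(Y,Y)`,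
`dρ(Y) = |∇ρ|²`, `div Y = Δρ`).

Main statements: `mvfderiv_normalizedAcceleration_grad[_of_ne_zero]` (any dimension, any
signature), `integral_comp_mul_scalarCurvature_eq` (★ with boundary term `∫ d(η∘ρ)(X)`),
`mvfderiv_comp_normalizedAcceleration_grad_eq`, `integral_comp_mul_scalarCurvature_eq_sum_add_integral_deriv`
(★), `integral_comp_mul_scalarCurvature_eq_of_sublevel`. Everything is proved; no definitions, no
named facts, no `sorry`.

-- TODO(general form): identify `Σ_{ρ(p) < a} (−1)^{ind_p}` with `χ({ρ ≤ a})` (Milnor 1963,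
-- Thm. 5.2; the tree has the closed case `SphereMorseCount.morseCount_eq_relEuler`), and the
-- boundary term with `∫_{ρ = a} κ_N ds` in the limit `b ↓ a` (coarea / first variation of the
-- length of level curves).

## References

* J. M. Lee, *Introduction to Riemannian Manifolds*, 2nd ed., GTM 176, Springer 2018: Thm. 9.3
  (Gauss–Bonnet formula, PDF p. 279 = p. 273, with `κ_N = ⟨D_t γ', N⟩`), Thm. 9.7 (Gauss–Bonnet
  theorem), Problem 9-10 (surfaces with boundary: `∫_M K dA + ∫_{∂M} κ_N ds = 2πχ(M)`, `κ_N` with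
  respect to the inward normal; p. 281). [LeeRiemannianManifolds2018]
* J. Milnor, *Morse theory*, Ann. of Math. Studies 51 (1963), §2 (nondegenerate critical points,
  index), Thm. 5.2 (Morse count of sublevel sets), §6 (index of `grad f`). [Milnor1963]
* S.-S. Chern, *A simple intrinsic proof of the Gauss–Bonnet formula for closed Riemannian
  manifolds*, Ann. of Math. 45 (1944) 747–752 (the vector-field proof).
* B. O'Neill, *Semi-Riemannian geometry*, Academic Press 1983, Ch. 3, Lemma 3.49, Def. 3.50
  (`H^f(X,Y) = ⟨D_X grad f, Y⟩`, `Δf = div grad f`). [ONeill1983]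
* R. Schoen, S.-T. Yau, *On the proof of the positive mass conjecture in general relativity*,
  Comm. Math. Phys. 65 (1979) 45–76, §2, pp. 57–63 (second proof of the Claim: Gauss–Bonnet on
  `D_σ ⊂ S`, (2.26)–(2.42)). [SchoenYauPMT1979]
-/

open Bundle Set Metric Filter Function MeasureTheory Module
open ContMDiffRiemannianMetric Literature.Geometry.Lorentzian
open Literature.Geometry.Lorentzian.PseudoRiemannianMetric Literature.Geometry.Riemannian.IndexFlux
open Literature.Topology.FourManifolds
open scoped ContDiff Manifold Topology RealInnerProductSpace Real

noncomputable section

namespace Literature.Geometry.Riemannian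

/-! ### The normalized acceleration field of a gradient, paired with the differential -/

section Identification

variable {E : Type*} [NormedAddCommGroup E] [NormedSpace ℝ E] {H : Type*} [TopologicalSpace H]
  {I : ModelWithCorners ℝ E H} [I.Boundaryless] {M : Type*} [TopologicalSpace M]
  [ChartedSpace H M] [IsManifold I ∞ M] [FiniteDimensional ℝ E] [CompleteSpace E]
  (g : PseudoRiemannianMetric I ∞ E (TangentSpace I : M → Type _)) [g.HasLeviCivita]

/-- **`dρ(X) = (Hess ρ(∇ρ, ∇ρ) − Δρ |∇ρ|²)/|∇ρ|²` for the normalized acceleration field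
`X = (∇_Y Y − (div Y) Y)/g(Y, Y)` of a gradient `Y = grad ρ`** (`ρ` of class `C²` at `x`):
`dρ(∇_Y Y) = g(Y, ∇_Y Y) = Hess ρ(Y, Y)` (`val_leviCivita_sharp_mvfderiv`), `dρ(Y) = g(Y, Y) = |∇ρ|²`
and `div Y = Δρ` (`vectorDivergence_sharp_mvfderiv`). At a critical point both sides are `0`
(`0⁻¹ = 0`). O'Neill 1983, Ch. 3, Lemma 3.49 and Def. 3.50. [cite: ONeill1983, Ch. 3, Lemma 3.49] -/
theorem mvfderiv_normalizedAcceleration_grad {ρ : M → ℝ} {x : M} (hρ : CMDiffAt 2 ρ x) :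
    mvfderiv I ρ x (normalizedAcceleration g (grad g ρ) x) =
      (g.gradSq ρ x)⁻¹ *
        (g.hessian ρ x (grad g ρ x) (grad g ρ x) - g.dalembertian ρ x * g.gradSq ρ x) := by
  have hY : grad g ρ = fun y ↦ (g.sharp y (mvfderiv I ρ y).toLinearMap : TangentSpace I y) := rfl
  have hval : g.val x (grad g ρ x) (grad g ρ x) = g.gradSq ρ x := by
    rw [val_grad]; rfl
  have hL : mvfderiv I ρ x (g.leviCivita (grad g ρ) x (grad g ρ x)) =
      g.hessian ρ x (grad g ρ x) (grad g ρ x) := by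
    rw [← val_grad g ρ x, g.symm x, hY]
    exact g.val_leviCivita_sharp_mvfderiv hρ _ _
  have hD : g.vectorDivergence (grad g ρ) x = g.dalembertian ρ x := by
    rw [hY]; exact vectorDivergence_sharp_mvfderiv hρ
  have hYx : mvfderiv I ρ x (grad g ρ x) = g.gradSq ρ x := rfl
  rw [normalizedAcceleration_apply, map_smul, map_sub, map_smul, hval, hL, hD, hYx, smul_eq_mul,
    smul_eq_mul]

/-- The same identity in divided form where `∇ρ ≠ 0`:
`dρ(X) = Hess ρ(∇ρ, ∇ρ)/|∇ρ|² − Δρ`. [cite: ONeill1983, Ch. 3, Lemma 3.49] -/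
theorem mvfderiv_normalizedAcceleration_grad_of_ne_zero {ρ : M → ℝ} {x : M} (hρ : CMDiffAt 2 ρ x)
    (hx : g.gradSq ρ x ≠ 0) :
    mvfderiv I ρ x (normalizedAcceleration g (grad g ρ) x) =
      g.hessian ρ x (grad g ρ x) (grad g ρ x) / g.gradSq ρ x - g.dalembertian ρ x := by
  rw [mvfderiv_normalizedAcceleration_grad g hρ]
  field_simp

end Identification

/-! ### The weighted Gauss–Bonnet formula -/

section Main

variable {N : Type*} [TopologicalSpace N] [ChartedSpace (EuclideanSpace ℝ (Fin 2)) N]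
  [IsManifold (𝓡 2) ∞ N] [T2Space N] [LocallyCompactSpace N] [SigmaCompactSpace N]
  [MeasurableSpace N] [BorelSpace N]

set_option backward.isDefEq.respectTransparency false in
set_option maxHeartbeats 1600000 in
/-- **The weighted Gauss–Bonnet formula (Gauss–Bonnet with boundary, flux form).** Let `(N, G)`
be a Riemannian surface modelled on `ℝ²` (Hausdorff, locally compact, σ-compact; compactness is
NOT assumed), `ρ` a Morse function, `η : ℝ → ℝ` smooth with `η ∘ ρ` compactly supported and `η`
locally constant near each critical value `ρ(p)`, and `C` a finite set of critical points
containing those in `tsupport (η ∘ ρ)`. Then, with `X = (∇_Y Y − (div Y) Y)/g(Y,Y)`, `Y = grad ρ`,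

  `∫_N η(ρ) S dμ = 4π Σ_{p ∈ C} (−1)^{ind_p ρ} η(ρ(p)) − 2 ∫_N d(η ∘ ρ)(X) dμ`.

The boundary integrand `d(η∘ρ)(X) = η'(ρ) dρ(X) = −η'(ρ)(Δρ − Hess ρ(n,n)) = −η'(ρ) |∇ρ| k` is smooth,
compactly supported and vanishes near the critical points
(`mvfderiv_comp_normalizedAcceleration_grad_eq`). This is Lee 2018, Problem 9-10 / Thm. 9.3
(`∫_D K + ∫_{∂D} κ_N = 2πχ(D)`, `S = 2K`) for the sublevel sets `D = {ρ ≤ t}` integrated against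
`−η'(t) dt`, proved directly by the Poincaré–Hopf route (module docstring); for `η ≡ 1` on a compact
surface it is `GaussBonnet.integral_scalarCurvature_riemannianMeasure_eq` before the Morse count.
[cite: LeeRiemannianManifolds2018, Problem 9-10 and Thm. 9.3] -/
theorem integral_comp_mul_scalarCurvature_eq
    (G : ContMDiffRiemannianMetric (𝓡 2) ∞ (EuclideanSpace ℝ (Fin 2))
      (TangentSpace (𝓡 2) : N → Type _)) [(ofRiemannian G).HasLeviCivita]
    {ρ : N → ℝ} (hρ : IsMorse (𝓡 2) ρ) {η : ℝ → ℝ} (hη : ContDiff ℝ ∞ η)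
    (hsupp : HasCompactSupport (η ∘ ρ))
    (hcrit : ∀ p, IsMCriticalPt (𝓡 2) ρ p → η =ᶠ[𝓝 (ρ p)] fun _ ↦ η (ρ p))
    (C : Finset N) (hC : ∀ p ∈ C, IsMCriticalPt (𝓡 2) ρ p)
    (hC' : ∀ p, IsMCriticalPt (𝓡 2) ρ p → p ∈ tsupport (η ∘ ρ) → p ∈ C) :
    ∫ y, η (ρ y) * (ofRiemannian G).scalarCurvature y ∂riemannianMeasure G =
      4 * π * ∑ p ∈ C, (-1 : ℝ) ^ morseIndex (𝓡 2) ρ p * η (ρ p) -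
        2 * ∫ y, mvfderiv (𝓡 2) (η ∘ ρ) y
          (normalizedAcceleration (ofRiemannian G) (grad (ofRiemannian G) ρ) y)
            ∂riemannianMeasure G := by
  classical
  letI : RiemannianBundle (fun x : N ↦ TangentSpace (𝓡 2) x) :=
    ⟨G.toContinuousRiemannianMetric.toRiemannianMetric⟩
  haveI : SecondCountableTopology N :=
    ChartedSpace.secondCountable_of_sigmaCompact (EuclideanSpace ℝ (Fin 2)) N
  haveI : T3Space N := inferInstance
  -- notation
  set g := ofRiemannian G with hg
  set μ := riemannianMeasure G with hμ
  set S := g.scalarCurvature with hSdef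
  have h2 : finrank ℝ (EuclideanSpace ℝ (Fin 2)) = 2 := finrank_euclideanSpace_fin
  have hgR : g.IsRiemannian := isRiemannian_ofRiemannian G
  have hSc : Continuous S := (contMDiff_scalarCurvature g).continuous
  -- ### Step 1: the Morse function, its gradient, the weight
  have hρs : ContMDiff (𝓡 2) 𝓘(ℝ, ℝ) ∞ ρ := hρ.contMDiff
  have hηρ : ContMDiff (𝓡 2) 𝓘(ℝ, ℝ) ∞ (η ∘ ρ) := hη.comp_contMDiff hρs
  set Y : Π x : N, TangentSpace (𝓡 2) x := grad g ρ with hYdef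
  have hY : ContMDiff (𝓡 2) ((𝓡 2).prod 𝓘(ℝ, EuclideanSpace ℝ (Fin 2))) ∞ fun y ↦
      (TotalSpace.mk' (EuclideanSpace ℝ (Fin 2)) y (Y y) : TangentBundle (𝓡 2) N) :=
    contMDiff_grad g hρs
  have hY0 : ∀ x, Y x = 0 ↔ IsMCriticalPt (𝓡 2) ρ x := fun x ↦ by
    rw [hYdef, grad_eq_zero_iff]; rfl
  set X : Π x : N, TangentSpace (𝓡 2) x := normalizedAcceleration g Y with hXdef
  have hXs : ∀ x, ¬ IsMCriticalPt (𝓡 2) ρ x →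
      ContMDiffAt (𝓡 2) ((𝓡 2).prod 𝓘(ℝ, EuclideanSpace ℝ (Fin 2))) ∞
        (fun y ↦ (TotalSpace.mk' (EuclideanSpace ℝ (Fin 2)) y (X y) : TangentBundle (𝓡 2) N)) x :=
    fun x hx ↦ contMDiffAt_normalizedAcceleration_of_ne_zero g hgR hY fun h0 ↦ hx ((hY0 x).1 h0)
  have hdivX : ∀ x, ¬ IsMCriticalPt (𝓡 2) ρ x → g.vectorDivergence X x = S x / 2 := fun x hx ↦
    vectorDivergence_normalizedAcceleration g h2 hgR hY.contMDiffOn fun h0 ↦ hx ((hY0 x).1 h0)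
  -- the weight is locally constant near every critical point, and so is its differential zero
  have hηc : ∀ p, IsMCriticalPt (𝓡 2) ρ p → ∀ᶠ y in 𝓝 p, η (ρ y) = η (ρ p) := fun p hp ↦
    (hρs.continuous.continuousAt (x := p)).eventually (hcrit p hp)
  -- the boundary integrand `B = d(η ∘ ρ)(X)`
  set B : N → ℝ := fun y ↦ mvfderiv (𝓡 2) (η ∘ ρ) y (X y) with hBdef
  have hB0 : ∀ p, IsMCriticalPt (𝓡 2) ρ p → B =ᶠ[𝓝 p] fun _ ↦ 0 := by
    intro p hp
    have hev : ∀ᶠ y in 𝓝 p, (η ∘ ρ) =ᶠ[𝓝 y] fun _ ↦ η (ρ p) :=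
      (hηc p hp).eventually_nhds
    filter_upwards [hev] with y hy
    simp only [hBdef]
    rw [mvfderiv_congr_of_eventuallyEq' hy]
    simp [mvfderiv_real_apply, mfderiv_const]
  have hBs : ContMDiff (𝓡 2) 𝓘(ℝ, ℝ) 1 B := by
    intro y
    by_cases hyC : IsMCriticalPt (𝓡 2) ρ y
    · exact contMDiffAt_const.congr_of_eventuallyEq (hB0 y hyC)
    · exact contMDiffAt_mvfderiv_apply ((hηρ y).of_le (by norm_cast))
        ((hXs y hyC).of_le (by norm_cast))
  have hBc : Continuous B := hBs.continuous
  have hBsupp : HasCompactSupport B := by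
    refine hsupp.mono' fun y hy ↦ ?_
    by_contra hyt
    rw [mem_support] at hy
    apply hy
    simp only [hBdef]
    rw [mvfderiv_eq_zero_of_notMem_tsupport hyt, _root_.zero_apply]
  have hBi : Integrable B μ := integrable_of_continuous_of_hasCompactSupport G hBc hBsupp
  -- ### Step 2: the local data at each critical point of `C`
  have hdata : ∀ p ∈ C, ∃ T : EuclideanSpace ℝ (Fin 2) ≃L[ℝ] EuclideanSpace ℝ (Fin 2),
      ∃ Cp r₀ : ℝ, 0 < r₀ ∧
      closedBall (extChartAt (𝓡 2) p p)
          (2 * r₀ * ‖(T.symm : EuclideanSpace ℝ (Fin 2) →L[ℝ] EuclideanSpace ℝ (Fin 2))‖) ⊆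
        (extChartAt (𝓡 2) p).target ∧
      ∀ r, 0 < r → r < r₀ →
        Continuous (fun y ↦ mvfderiv (𝓡 2) (mcutoff (𝓡 2) p
          (T : EuclideanSpace ℝ (Fin 2) →L[ℝ] EuclideanSpace ℝ (Fin 2)) r) y (X y)) ∧
        |(∫ y, mvfderiv (𝓡 2) (mcutoff (𝓡 2) p
            (T : EuclideanSpace ℝ (Fin 2) →L[ℝ] EuclideanSpace ℝ (Fin 2)) r) y (X y) ∂μ) +
          2 * π * (-1 : ℝ) ^ morseIndex (𝓡 2) ρ p| ≤ Cp * r := by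
    intro p hp
    obtain ⟨L, hL, hsign⟩ := exists_linearization_grad G hρ (hC p hp)
    obtain ⟨A₀, hA₀⟩ := exists_norm_eq_norm_symmL (I := 𝓡 2) p p
    obtain ⟨A, hA⟩ :=
      exists_continuousLinearEquiv_of_norm_eq_norm_symmL p p (mem_chart_source _ p) hA₀
    have hA' : ∀ v w, metricRep (𝓡 2) g p (extChartAt (𝓡 2) p p) v w = ⟪A v, A w⟫ := by
      intro v w
      rw [hA v, hA w, inner_eq_inner_symmL_of_norm_eq p p hA₀ v w, metricRep_apply_eq_val_symmL,
        extChartAt_to_inv (I := 𝓡 2) p]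
      rfl
    obtain ⟨Cp, r₀, hr₀, hcl, -, hflux⟩ :=
      abs_integral_mvfderiv_mcutoff_add_le G p hY ((hY0 p).2 (hC p hp)) L hL A hA'
    refine ⟨L.trans A, Cp, r₀, hr₀, hcl, fun r hr hrr ↦ ?_⟩
    obtain ⟨hc, hb⟩ := hflux r hr hrr
    rw [hsign] at hb
    exact ⟨hc, hb⟩
  choose! T Cst r₀ hr₀ hcl hflux using hdata
  -- bounds for the density near each critical point, for the weight, and for the scalar
  -- curvature on the support of the weight
  have hdens : ∀ p ∈ C, ∃ B : ℝ, 0 ≤ B ∧ ∀ e ∈ closedBall (extChartAt (𝓡 2) p p)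
      (2 * r₀ p * ‖((T p).symm : EuclideanSpace ℝ (Fin 2) →L[ℝ] EuclideanSpace ℝ (Fin 2))‖),
      Real.sqrt (chartGramMatrix G p e).det ≤ B := by
    intro p hp
    obtain ⟨B, hB⟩ := (isCompact_closedBall _ _).exists_bound_of_continuousOn
      ((contDiffOn_sqrt_det_chartGramMatrix G p).continuousOn.mono (hcl p hp))
    refine ⟨max B 0, le_max_right _ _, fun e he ↦ ?_⟩
    exact ((le_abs_self _).trans (((Real.norm_eq_abs _).symm.le).trans (hB e he))).trans
      (le_max_left _ _)
  choose! Bd hBd0 hBd using hdens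
  set K : Set N := tsupport (η ∘ ρ) with hKdef
  have hK : IsCompact K := hsupp
  obtain ⟨MS₀, hMS₀⟩ := hK.exists_bound_of_continuousOn hSc.continuousOn
  set MS : ℝ := max MS₀ 0 with hMSdef
  have hMS : ∀ y ∈ K, |S y| ≤ MS := fun y hy ↦
    ((Real.norm_eq_abs _).symm.le.trans (hMS₀ y hy)).trans (le_max_left _ _)
  have hMS0 : 0 ≤ MS := le_max_right _ _
  obtain ⟨Mη₀, hMη₀⟩ := hηρ.continuous.bounded_above_of_compact_support hsupp
  set Mη : ℝ := max Mη₀ 0 with hMηdef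
  have hMη : ∀ y, |η (ρ y)| ≤ Mη := fun y ↦
    ((Real.norm_eq_abs _).symm.le.trans (hMη₀ y)).trans (le_max_left _ _)
  have hMη0 : 0 ≤ Mη := le_max_right _ _
  -- ### Step 3: separate the critical points and choose a common small radius
  obtain ⟨U, hU, hUdisj⟩ := (C.finite_toSet).t2_separation
  -- shrink the separating neighbourhoods: the weight is constant and `B = 0` on them
  set U' : N → Set N := fun p ↦ U p ∩ {y | η (ρ y) = η (ρ p) ∧ B y = 0} with hU'
  have hU' : ∀ p ∈ C, p ∈ U' p ∧ U' p ∈ 𝓝 p := by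
    intro p hp
    have hpC : IsMCriticalPt (𝓡 2) ρ p := hC p hp
    have hev : ∀ᶠ y in 𝓝 p, η (ρ y) = η (ρ p) ∧ B y = 0 :=
      (hηc p hpC).and ((hB0 p hpC).mono fun y hy ↦ hy)
    refine ⟨⟨(hU p).1, rfl, ?_⟩, Filter.inter_mem ((hU p).2.mem_nhds (hU p).1) hev⟩
    exact (hB0 p hpC).self_of_nhds
  have hε : ∀ p ∈ C, ∃ ε : ℝ, 0 < ε ∧
      ∀ e ∈ ball (extChartAt (𝓡 2) p p) ε, (extChartAt (𝓡 2) p).symm e ∈ U' p := by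
    intro p hp
    have h2' : (extChartAt (𝓡 2) p).symm ⁻¹' U' p ∈ 𝓝 (extChartAt (𝓡 2) p p) := by
      refine (continuousAt_extChartAt_symm p).preimage_mem_nhds ?_
      rw [extChartAt_to_inv]
      exact (hU' p hp).2
    obtain ⟨ε, hε, hball⟩ := Metric.mem_nhds_iff.1 h2'
    exact ⟨ε, hε, fun e he ↦ hball he⟩
  choose! ε hε hεU using hε
  set nT : N → ℝ := fun p ↦
    ‖((T p).symm : EuclideanSpace ℝ (Fin 2) →L[ℝ] EuclideanSpace ℝ (Fin 2))‖ with hnT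
  have hnT0 : ∀ p, 0 ≤ nT p := fun p ↦ norm_nonneg _
  set ρr : N → ℝ := fun p ↦ min (r₀ p) (ε p / (2 * (nT p + 1))) with hρr
  have hρpos : ∀ p ∈ C, 0 < ρr p := fun p hp ↦
    lt_min (hr₀ p hp) (div_pos (hε p hp) (by have := hnT0 p; positivity))
  obtain ⟨r₁, hr₁, hr₁1, hr₁C⟩ : ∃ r₁ : ℝ, 0 < r₁ ∧ r₁ ≤ 1 ∧ ∀ p ∈ C, r₁ ≤ ρr p := by
    refine ⟨(insert 1 (C.image ρr)).min' (Finset.insert_nonempty _ _), ?_,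
      Finset.min'_le _ _ (Finset.mem_insert_self _ _),
      fun p hp ↦ Finset.min'_le _ _ (Finset.mem_insert_of_mem (Finset.mem_image_of_mem _ hp))⟩
    have hmem := (insert 1 (C.image ρr)).min'_mem (Finset.insert_nonempty _ _)
    rcases Finset.mem_insert.1 hmem with h | h
    · rw [h]; exact one_pos
    · obtain ⟨p, hp, hpe⟩ := Finset.mem_image.1 h
      rw [← hpe]; exact hρpos p hp
  -- ### Step 4: the main estimate for `0 < r < r₁`
  set K₁ : ℝ := ∑ p ∈ C, |η (ρ p)| * Cst p with hK₁
  set K₂ : ℝ := Mη * (MS / 2) * ∑ p ∈ C, Bd p * (π * (2 * nT p) ^ 2) with hK₂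
  set σ : ℝ := ∑ p ∈ C, (-1 : ℝ) ^ morseIndex (𝓡 2) ρ p * η (ρ p) with hσ
  have hkey : ∀ r, 0 < r → r < r₁ →
      |(∫ y, η (ρ y) * (S y / 2) ∂μ) - 2 * π * σ + ∫ y, B y ∂μ| ≤ (K₁ + K₂) * r := by
    intro r hr hrr₁
    -- facts at each critical point
    have hrr₀ : ∀ p ∈ C, r < r₀ p := fun p hp ↦
      (hrr₁.trans_le (hr₁C p hp)).trans_le (min_le_left _ _)
    have hrε : ∀ p ∈ C, 2 * r * nT p < ε p := by
      intro p hp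
      have h1 : r < ε p / (2 * (nT p + 1)) :=
        (hrr₁.trans_le (hr₁C p hp)).trans_le (min_le_right _ _)
      rw [lt_div_iff₀ (by have := hnT0 p; positivity)] at h1
      nlinarith [hnT0 p]
    have hclr : ∀ p ∈ C, closedBall (extChartAt (𝓡 2) p p) (2 * r * nT p) ⊆
        (extChartAt (𝓡 2) p).target := fun p hp ↦
      (closedBall_subset_closedBall (by have := hnT0 p; have := hrr₀ p hp; nlinarith)).trans
        (hcl p hp)
    have hKU : ∀ p ∈ C, mcutoffSupport (𝓡 2) p (T p) r ⊆ U' p := by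
      rintro p hp _ ⟨e, he, rfl⟩
      exact hεU p hp e (closedBall_subset_ball (hrε p hp) he)
    have hKdisj : ∀ p ∈ C, ∀ q ∈ C, q ≠ p → ∀ y ∈ mcutoffSupport (𝓡 2) p (T p) r,
        y ∉ mcutoffSupport (𝓡 2) q (T q) r := by
      intro p hp q hq hqp y hyp hyq
      have hd := hUdisj (Finset.mem_coe.2 hp) (Finset.mem_coe.2 hq) (Ne.symm hqp)
      exact Set.disjoint_left.1 hd (hKU p hp hyp).1 (hKU q hq hyq).1
    -- the global cutoff `χ = ∏_p χ_p`
    set m : N → N → ℝ := fun p ↦ mcutoff (𝓡 2) p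
      ((T p : EuclideanSpace ℝ (Fin 2) ≃L[ℝ] EuclideanSpace ℝ (Fin 2)) :
        EuclideanSpace ℝ (Fin 2) →L[ℝ] EuclideanSpace ℝ (Fin 2)) r with hm
    set χ : N → ℝ := fun y ↦ ∏ p ∈ C, m p y with hχ
    have hms : ∀ p ∈ C, ContMDiff (𝓡 2) 𝓘(ℝ, ℝ) ∞ (m p) := fun p hp ↦
      contMDiff_mcutoff p (T p) hr (hclr p hp)
    have hχs : ContMDiff (𝓡 2) 𝓘(ℝ, ℝ) ∞ χ := contMDiff_finsetProd hms
    have hχ0 : ∀ p ∈ C, χ =ᶠ[𝓝 p] fun _ ↦ 0 := by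
      intro p hp
      filter_upwards [mcutoff_eventuallyEq_zero (I := 𝓡 2) p
        ((T p : EuclideanSpace ℝ (Fin 2) ≃L[ℝ] EuclideanSpace ℝ (Fin 2)) :
          EuclideanSpace ℝ (Fin 2) →L[ℝ] EuclideanSpace ℝ (Fin 2)) r] with y hy
      exact Finset.prod_eq_zero hp hy
    have hχ1 : ∀ y, (∀ q ∈ C, y ∉ mcutoffSupport (𝓡 2) q (T q) r) → χ =ᶠ[𝓝 y] fun _ ↦ 1 := by
      intro y hy
      have hev : ∀ᶠ z in 𝓝 y, ∀ q ∈ C, m q z = 1 :=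
        (Filter.eventually_all_finset C).2 fun q hq ↦
          mcutoff_eventuallyEq_one q (T q) hr (hclr q hq) (hy q hq)
      filter_upwards [hev] with z hz
      exact Finset.prod_eq_one hz
    have hχp : ∀ p ∈ C, ∀ y ∈ mcutoffSupport (𝓡 2) p (T p) r, χ =ᶠ[𝓝 y] m p := by
      intro p hp y hy
      have hev : ∀ᶠ z in 𝓝 y, ∀ q ∈ C.erase p, m q z = 1 :=
        (Filter.eventually_all_finset (C.erase p)).2 fun q hq ↦
          mcutoff_eventuallyEq_one q (T q) hr (hclr q (Finset.mem_of_mem_erase hq))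
            (hKdisj p hp q (Finset.mem_of_mem_erase hq) (Finset.ne_of_mem_erase hq) y hy)
      filter_upwards [hev] with z hz
      show ∏ q ∈ C, m q z = m p z
      rw [← Finset.mul_prod_erase C _ hp, Finset.prod_eq_one hz, mul_one]
    have hχ01 : ∀ y, 0 ≤ χ y ∧ χ y ≤ 1 := fun y ↦
      ⟨Finset.prod_nonneg fun p _ ↦ mcutoff_nonneg _ _ _ _,
        Finset.prod_le_one (fun p _ ↦ mcutoff_nonneg _ _ _ _) fun p _ ↦ mcutoff_le_one _ _ _ _⟩
    have hχ1' : ∀ y, (∀ q ∈ C, y ∉ mcutoffSupport (𝓡 2) q (T q) r) → χ y = 1 := fun y hy ↦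
      (hχ1 y hy).self_of_nhds
    -- the fluxes `u_p = dχ_p(X)` and `dχ(X) = Σ_p u_p`
    set uf : N → N → ℝ := fun p y ↦ mvfderiv (𝓡 2) (m p) y (X y) with huf
    have hu0 : ∀ p ∈ C, ∀ y, y ∉ mcutoffSupport (𝓡 2) p (T p) r → uf p y = 0 := by
      intro p hp y hy
      simp only [huf, hm]
      rw [mvfderiv_mcutoff_eq_zero p (T p) hr (hclr p hp) hy, _root_.zero_apply]
    have hdχ : ∀ y, mvfderiv (𝓡 2) χ y (X y) = ∑ p ∈ C, uf p y := by
      intro y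
      by_cases hyK : ∃ p ∈ C, y ∈ mcutoffSupport (𝓡 2) p (T p) r
      · obtain ⟨p, hp, hyp⟩ := hyK
        rw [mvfderiv_congr_of_eventuallyEq' (hχp p hp y hyp), Finset.sum_eq_single_of_mem p hp]
        intro q hq hqp
        exact hu0 q hq y (hKdisj p hp q hq hqp y hyp)
      · push Not at hyK
        rw [mvfderiv_congr_of_eventuallyEq' (hχ1 y hyK),
          Finset.sum_eq_zero fun q hq ↦ hu0 q hq y (hyK q hq)]
        simp [mvfderiv_real_apply, mfderiv_const]
    -- the weight is constant on each cutoff region, and `B = 0` there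
    have hηK : ∀ p ∈ C, ∀ y ∈ mcutoffSupport (𝓡 2) p (T p) r, η (ρ y) = η (ρ p) :=
      fun p hp y hy ↦ (hKU p hp hy).2.1
    have hBK : ∀ p ∈ C, ∀ y ∈ mcutoffSupport (𝓡 2) p (T p) r, B y = 0 :=
      fun p hp y hy ↦ (hKU p hp hy).2.2
    -- the cut-off field `W = (η ∘ ρ) • χ • X` is `C^∞` with compact support
    set W : Π x : N, TangentSpace (𝓡 2) x := fun y ↦ (η (ρ y)) • ((χ y) • X y) with hWdef
    have hW0C : ∀ y ∈ C, ∀ᶠ z in 𝓝 y, W z = 0 := by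
      intro y hyC
      filter_upwards [hχ0 y hyC] with z hz
      show η (ρ z) • (χ z • X z) = 0
      rw [hz, zero_smul, smul_zero]
    have hW0' : ∀ y, IsMCriticalPt (𝓡 2) ρ y → y ∉ C → ∀ᶠ z in 𝓝 y, W z = 0 := by
      intro y hy hyC
      have hyt : y ∉ tsupport (η ∘ ρ) := fun h ↦ hyC (hC' y hy h)
      filter_upwards [(isClosed_tsupport (η ∘ ρ)).isOpen_compl.mem_nhds hyt] with z hz
      have h0 : (η ∘ ρ) z = 0 := image_eq_zero_of_notMem_tsupport hz
      show η (ρ z) • (χ z • X z) = 0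
      rw [show η (ρ z) = 0 from h0, zero_smul]
    have hχX : ∀ y, ¬ IsMCriticalPt (𝓡 2) ρ y →
        ContMDiffAt (𝓡 2) ((𝓡 2).prod 𝓘(ℝ, EuclideanSpace ℝ (Fin 2))) ∞
          (fun z ↦ (TotalSpace.mk' (EuclideanSpace ℝ (Fin 2)) z (χ z • X z) :
            TangentBundle (𝓡 2) N)) y :=
      fun y hy ↦ (hχs y).smul_section (hXs y hy)
    have hW : ContMDiff (𝓡 2) ((𝓡 2).prod 𝓘(ℝ, EuclideanSpace ℝ (Fin 2))) ∞ fun y ↦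
        (TotalSpace.mk' (EuclideanSpace ℝ (Fin 2)) y (W y) : TangentBundle (𝓡 2) N) := by
      intro y
      by_cases hyc : IsMCriticalPt (𝓡 2) ρ y
      · have h0 : ∀ᶠ z in 𝓝 y, W z = 0 := by
          by_cases hyC : y ∈ C
          · exact hW0C y hyC
          · exact hW0' y hyc hyC
        refine (contMDiffAt_zeroSection ℝ
          (TangentSpace (𝓡 2) : N → Type _)).congr_of_eventuallyEq ?_
        filter_upwards [h0] with z hz
        show TotalSpace.mk' (EuclideanSpace ℝ (Fin 2)) z (W z) = ⟨z, 0⟩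
        rw [hz]
      · exact (hηρ y).smul_section (hχX y hyc)
    have hWc : HasCompactSupport fun y ↦ (W y : EuclideanSpace ℝ (Fin 2)) := by
      refine hsupp.mono fun y hy ↦ ?_
      rw [mem_support] at hy ⊢
      intro h0
      apply hy
      show η (ρ y) • (χ y • X y) = 0
      rw [show η (ρ y) = 0 from h0, zero_smul]
    -- divergence of `W`: `div W = (η∘ρ) χ S/2 + (η∘ρ) Σ_p u_p + χ B`
    have hdivW : ∀ y, g.vectorDivergence W y =
        η (ρ y) * χ y * (S y / 2) + η (ρ y) * ∑ p ∈ C, uf p y + χ y * B y := by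
      intro y
      by_cases hyc : IsMCriticalPt (𝓡 2) ρ y
      · by_cases hyC : y ∈ C
        · have hχy : χ y = 0 := (hχ0 y hyC).self_of_nhds
          have hd0 : mvfderiv (𝓡 2) χ y (X y) = 0 := by
            rw [mvfderiv_congr_of_eventuallyEq' (hχ0 y hyC)]
            simp [mvfderiv_real_apply, mfderiv_const]
          rw [vectorDivergence_eq_zero_of_eventuallyEq_zero (hW0C y hyC), ← hdχ y, hχy, hd0]
          ring
        · have hηy : (η ∘ ρ) y = 0 :=
            image_eq_zero_of_notMem_tsupport fun h ↦ hyC (hC' y hyc h)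
          rw [Function.comp_apply] at hηy
          have hBy : B y = 0 := (hB0 y hyc).self_of_nhds
          rw [vectorDivergence_eq_zero_of_eventuallyEq_zero (hW0' y hyc hyC), hηy, hBy]
          ring
      · have h1 : g.vectorDivergence W y = η (ρ y) * g.vectorDivergence (fun z ↦ χ z • X z) y +
            mvfderiv (𝓡 2) (η ∘ ρ) y (χ y • X y) :=
          vectorDivergence_smul (g := g) (u := η ∘ ρ) ((hχX y hyc).mdifferentiableAt (by simp))
            ((hηρ y).mdifferentiableAt (by simp))
        have h2' : g.vectorDivergence (fun z ↦ χ z • X z) y =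
            χ y * g.vectorDivergence X y + mvfderiv (𝓡 2) χ y (X y) :=
          vectorDivergence_smul (g := g) (u := χ) ((hXs y hyc).mdifferentiableAt (by simp))
            ((hχs y).mdifferentiableAt (by simp))
        rw [h1, h2', hdivX y hyc, hdχ y, map_smul, smul_eq_mul]
        simp only [hBdef]
        ring
    -- the divergence theorem for the compactly supported field `W`
    have hint0 : ∫ y, g.vectorDivergence W y ∂μ = 0 :=
      integral_vectorDivergence_eq_zero_of_hasCompactSupport G
        (hW.of_le (by exact_mod_cast (le_top : (1 : ℕ∞) ≤ ⊤))) hWc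
    -- integrability of the three terms
    have hT1c : Continuous fun y ↦ η (ρ y) * χ y * (S y / 2) :=
      (hηρ.continuous.mul hχs.continuous).mul (hSc.div_const _)
    have hT1i : Integrable (fun y ↦ η (ρ y) * χ y * (S y / 2)) μ := by
      refine integrable_of_continuous_of_hasCompactSupport G hT1c ?_
      exact (hsupp.mul_right (f' := fun y ↦ χ y)).mul_right
    have hui : ∀ p ∈ C, Integrable (uf p) μ := fun p hp ↦
      integrable_of_continuous_of_hasCompactSupport G (hflux p hp r hr (hrr₀ p hp)).1
        (HasCompactSupport.intro (isCompact_mcutoffSupport p (T p) (hclr p hp)) (hu0 p hp))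
    have hT2i : Integrable (fun y ↦ η (ρ y) * ∑ p ∈ C, uf p y) μ := by
      have : (fun y ↦ η (ρ y) * ∑ p ∈ C, uf p y) = fun y ↦ ∑ p ∈ C, η (ρ p) * uf p y := by
        funext y
        rw [Finset.mul_sum]
        refine Finset.sum_congr rfl fun p hp ↦ ?_
        by_cases hy : y ∈ mcutoffSupport (𝓡 2) p (T p) r
        · rw [hηK p hp y hy]
        · rw [hu0 p hp y hy, mul_zero, mul_zero]
      rw [this]
      exact integrable_finsetSum _ fun p hp ↦ (hui p hp).const_mul _
    have hT3i : Integrable (fun y ↦ χ y * B y) μ := by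
      have : (fun y ↦ χ y * B y) = B := by
        funext y
        by_cases hyK : ∃ p ∈ C, y ∈ mcutoffSupport (𝓡 2) p (T p) r
        · obtain ⟨p, hp, hyp⟩ := hyK
          rw [hBK p hp y hyp, mul_zero]
        · push Not at hyK
          rw [hχ1' y hyK, one_mul]
      rw [this]
      exact hBi
    -- splitting the divergence identity
    have hsplit : (∫ y, η (ρ y) * χ y * (S y / 2) ∂μ) =
        -(∑ p ∈ C, η (ρ p) * ∫ y, uf p y ∂μ) - ∫ y, B y ∂μ := by
      have hT2 : (∫ y, η (ρ y) * ∑ p ∈ C, uf p y ∂μ) = ∑ p ∈ C, η (ρ p) * ∫ y, uf p y ∂μ := by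
        have : (fun y ↦ η (ρ y) * ∑ p ∈ C, uf p y) = fun y ↦ ∑ p ∈ C, η (ρ p) * uf p y := by
          funext y
          rw [Finset.mul_sum]
          refine Finset.sum_congr rfl fun p hp ↦ ?_
          by_cases hy : y ∈ mcutoffSupport (𝓡 2) p (T p) r
          · rw [hηK p hp y hy]
          · rw [hu0 p hp y hy, mul_zero, mul_zero]
        rw [this, integral_finsetSum _ fun p hp ↦ (hui p hp).const_mul _]
        refine Finset.sum_congr rfl fun p _ ↦ ?_
        exact integral_const_mul _ _
      have hT3 : (∫ y, χ y * B y ∂μ) = ∫ y, B y ∂μ := by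
        refine integral_congr_ae (ae_of_all _ fun y ↦ ?_)
        by_cases hyK : ∃ p ∈ C, y ∈ mcutoffSupport (𝓡 2) p (T p) r
        · obtain ⟨p, hp, hyp⟩ := hyK
          show χ y * B y = B y
          rw [hBK p hp y hyp, mul_zero]
        · push Not at hyK
          show χ y * B y = B y
          rw [hχ1' y hyK, one_mul]
      have h1 : ∫ y, g.vectorDivergence W y ∂μ =
          (∫ y, η (ρ y) * χ y * (S y / 2) ∂μ) + (∫ y, η (ρ y) * ∑ p ∈ C, uf p y ∂μ) +
            ∫ y, χ y * B y ∂μ := by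
        rw [integral_congr_ae (ae_of_all _ hdivW), integral_add _ hT3i, integral_add hT1i hT2i]
        exact hT1i.add hT2i
      rw [h1, hT2, hT3] at hint0
      linarith
    -- the flux estimate
    have hfluxsum : |(∑ p ∈ C, η (ρ p) * ∫ y, uf p y ∂μ) + 2 * π * σ| ≤ K₁ * r := by
      have : (∑ p ∈ C, η (ρ p) * ∫ y, uf p y ∂μ) + 2 * π * σ =
          ∑ p ∈ C, η (ρ p) * ((∫ y, uf p y ∂μ) + 2 * π * (-1 : ℝ) ^ morseIndex (𝓡 2) ρ p) := by
        rw [hσ, Finset.mul_sum, ← Finset.sum_add_distrib]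
        refine Finset.sum_congr rfl fun p _ ↦ ?_
        ring
      rw [this, hK₁, Finset.sum_mul]
      refine (Finset.abs_sum_le_sum_abs _ _).trans (Finset.sum_le_sum fun p hp ↦ ?_)
      calc |η (ρ p) * ((∫ y, uf p y ∂μ) + 2 * π * (-1 : ℝ) ^ morseIndex (𝓡 2) ρ p)|
          = |η (ρ p)| * |(∫ y, uf p y ∂μ) + 2 * π * (-1 : ℝ) ^ morseIndex (𝓡 2) ρ p| :=
            abs_mul _ _
        _ ≤ |η (ρ p)| * (Cst p * r) :=
            mul_le_mul_of_nonneg_left (hflux p hp r hr (hrr₀ p hp)).2 (abs_nonneg _)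
        _ = |η (ρ p)| * Cst p * r := by ring
    -- the cutoff error: `|∫ (η∘ρ)(1 - χ) S/2| ≤ K₂ r`
    have hKm : ∀ p ∈ C, MeasurableSet (mcutoffSupport (𝓡 2) p (T p) r) := fun p hp ↦
      (isCompact_mcutoffSupport p (T p) (hclr p hp)).isClosed.measurableSet
    haveI : IsFiniteMeasureOnCompacts μ :=
      ⟨fun K' hK' ↦ riemannianVolume_lt_top_of_isCompact_holds G le_rfl hK'⟩
    have hindI : ∀ p ∈ C, Integrable ((mcutoffSupport (𝓡 2) p (T p) r).indicator
        fun _ ↦ (1 : ℝ)) μ := fun p hp ↦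
      (integrableOn_const (C := (1 : ℝ))
        ((isCompact_mcutoffSupport p (T p) (hclr p hp)).measure_lt_top.ne)).integrable_indicator
        (hKm p hp)
    have hS1c : Continuous fun y ↦ η (ρ y) * (S y / 2) := hηρ.continuous.mul (hSc.div_const _)
    have hS1i : Integrable (fun y ↦ η (ρ y) * (S y / 2)) μ :=
      integrable_of_continuous_of_hasCompactSupport G hS1c hsupp.mul_right
    have herr : |(∫ y, η (ρ y) * (S y / 2) ∂μ) - ∫ y, η (ρ y) * χ y * (S y / 2) ∂μ| ≤ K₂ * r := by
      rw [← integral_sub hS1i hT1i]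
      set ind : N → ℝ := fun y ↦ ∑ p ∈ C, (mcutoffSupport (𝓡 2) p (T p) r).indicator
        (fun _ ↦ (1 : ℝ)) y with hind
      have hptw : ∀ y, |η (ρ y) * (S y / 2) - η (ρ y) * χ y * (S y / 2)| ≤
          Mη * (MS / 2) * ind y := by
        intro y
        by_cases hyK : ∃ p ∈ C, y ∈ mcutoffSupport (𝓡 2) p (T p) r
        · obtain ⟨p, hp, hyp⟩ := hyK
          have h1 : (1 : ℝ) ≤ ind y := by
            rw [hind]
            dsimp only
            rw [← Finset.add_sum_erase C _ hp, indicator_of_mem hyp]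
            have : 0 ≤ ∑ q ∈ C.erase p, (mcutoffSupport (𝓡 2) q (T q) r).indicator
                (fun _ ↦ (1 : ℝ)) y :=
              Finset.sum_nonneg fun q _ ↦ indicator_nonneg (fun _ _ ↦ zero_le_one) _
            linarith
          have hηS : |η (ρ y)| * |S y| ≤ Mη * MS := by
            by_cases hη0 : η (ρ y) = 0
            · rw [hη0, abs_zero, zero_mul]; positivity
            · have hyK' : y ∈ K := subset_tsupport _ (mem_support.2 hη0)
              exact mul_le_mul (hMη y) (hMS y hyK') (abs_nonneg _) hMη0
          have h3 : |η (ρ y) * (S y / 2) - η (ρ y) * χ y * (S y / 2)| =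
              (1 - χ y) * (|η (ρ y)| * |S y| / 2) := by
            rw [show η (ρ y) * (S y / 2) - η (ρ y) * χ y * (S y / 2) =
              (1 - χ y) * (η (ρ y) * S y / 2) by ring, abs_mul,
              abs_of_nonneg (by linarith [(hχ01 y).2]), abs_div, abs_mul, abs_two]
          rw [h3]
          calc (1 - χ y) * (|η (ρ y)| * |S y| / 2) ≤ 1 * (Mη * MS / 2) :=
                mul_le_mul (by linarith [(hχ01 y).1]) (by linarith [hηS]) (by positivity)
                  zero_le_one
            _ ≤ Mη * (MS / 2) * ind y := by
                have hprod : 0 ≤ Mη * (MS / 2) := by positivity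
                have := mul_le_mul_of_nonneg_left h1 hprod
                linarith
        · push Not at hyK
          have hχy : χ y = 1 := hχ1' y hyK
          have h0 : ind y = 0 := Finset.sum_eq_zero fun q hq ↦ indicator_of_notMem (hyK q hq) _
          rw [hχy, h0, mul_one, sub_self, abs_zero, mul_zero]
      have hindi : Integrable ind μ := integrable_finsetSum _ hindI
      have hI : |∫ y, η (ρ y) * (S y / 2) - η (ρ y) * χ y * (S y / 2) ∂μ| ≤
          ∫ y, Mη * (MS / 2) * ind y ∂μ := by
        refine (abs_integral_le_integral_abs).trans (integral_mono_of_nonneg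
          (ae_of_all _ fun y ↦ abs_nonneg _) (hindi.const_mul _) (ae_of_all _ hptw))
      refine hI.trans ?_
      rw [integral_const_mul]
      have hsum : ∫ y, ind y ∂μ =
          ∑ p ∈ C, ∫ y, (mcutoffSupport (𝓡 2) p (T p) r).indicator (fun _ ↦ (1 : ℝ)) y ∂μ := by
        simp only [hind]
        exact integral_finsetSum _ hindI
      rw [hsum]
      have hmeas : ∀ p ∈ C, ∫ y, (mcutoffSupport (𝓡 2) p (T p) r).indicator (fun _ ↦ (1 : ℝ)) y ∂μ
          ≤ Bd p * (π * (2 * nT p) ^ 2) * r := by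
        intro p hp
        have hio : ∫ y, (mcutoffSupport (𝓡 2) p (T p) r).indicator (fun _ ↦ (1 : ℝ)) y ∂μ =
            μ.real (mcutoffSupport (𝓡 2) p (T p) r) :=
          integral_indicator_one (hKm p hp)
        rw [hio]
        have h1 := measureReal_mcutoffSupport_le G p (T p) hr.le
          (show 2 * r * nT p ≤ 2 * r₀ p * nT p by
            have := hnT0 p; have := hrr₀ p hp; nlinarith) (hcl p hp) (hBd p hp)
        calc μ.real (mcutoffSupport (𝓡 2) p (T p) r) ≤ Bd p * (π * (2 * r * nT p) ^ 2) := h1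
          _ = Bd p * (π * (2 * nT p) ^ 2) * r * r := by ring
          _ ≤ Bd p * (π * (2 * nT p) ^ 2) * r * 1 := by
              have := hBd0 p hp
              have := hnT0 p
              exact mul_le_mul_of_nonneg_left (hrr₁.le.trans hr₁1) (by positivity)
          _ = Bd p * (π * (2 * nT p) ^ 2) * r := mul_one _
      rw [hK₂]
      calc Mη * (MS / 2) * ∑ p ∈ C, ∫ y, (mcutoffSupport (𝓡 2) p (T p) r).indicator
            (fun _ ↦ (1 : ℝ)) y ∂μ
          ≤ Mη * (MS / 2) * ∑ p ∈ C, Bd p * (π * (2 * nT p) ^ 2) * r :=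
            mul_le_mul_of_nonneg_left (Finset.sum_le_sum fun p hp ↦ hmeas p hp)
              (by positivity)
        _ = Mη * (MS / 2) * (∑ p ∈ C, Bd p * (π * (2 * nT p) ^ 2)) * r := by
            rw [← Finset.sum_mul]; ring
    -- combine
    calc |(∫ y, η (ρ y) * (S y / 2) ∂μ) - 2 * π * σ + ∫ y, B y ∂μ|
        = |((∫ y, η (ρ y) * (S y / 2) ∂μ) - ∫ y, η (ρ y) * χ y * (S y / 2) ∂μ) -
            ((∑ p ∈ C, η (ρ p) * ∫ y, uf p y ∂μ) + 2 * π * σ)| := by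
          rw [hsplit]; congr 1; ring
      _ ≤ |(∫ y, η (ρ y) * (S y / 2) ∂μ) - ∫ y, η (ρ y) * χ y * (S y / 2) ∂μ| +
            |(∑ p ∈ C, η (ρ p) * ∫ y, uf p y ∂μ) + 2 * π * σ| := abs_sub _ _
      _ ≤ K₂ * r + K₁ * r := add_le_add herr hfluxsum
      _ = (K₁ + K₂) * r := by ring
  -- ### Step 5: conclusion
  have hhalf : (∫ y, η (ρ y) * (S y / 2) ∂μ) = 2 * π * σ - ∫ y, B y ∂μ := by
    have := eq_of_abs_sub_le_mul (a := (∫ y, η (ρ y) * (S y / 2) ∂μ) + ∫ y, B y ∂μ)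
      (b := 2 * π * σ) (K := K₁ + K₂) hr₁ (fun r hr hrr ↦ by
        have h := hkey r hr hrr
        rwa [show (∫ y, η (ρ y) * (S y / 2) ∂μ) - 2 * π * σ + ∫ y, B y ∂μ =
          (∫ y, η (ρ y) * (S y / 2) ∂μ) + (∫ y, B y ∂μ) - 2 * π * σ by ring] at h)
    linarith
  have hS2 : (∫ y, η (ρ y) * S y ∂μ) = 2 * ∫ y, η (ρ y) * (S y / 2) ∂μ := by
    rw [← integral_const_mul]
    refine integral_congr_ae (ae_of_all _ fun y ↦ ?_)
    ring
  rw [hS2, hhalf, hσ]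
  ring

omit [T2Space N] [LocallyCompactSpace N] [SigmaCompactSpace N] [MeasurableSpace N]
  [BorelSpace N] in
/-- For a Riemannian metric the gradient square vanishes exactly off the critical points
(`|∇ρ|² = g(grad ρ, grad ρ) > 0` for `grad ρ ≠ 0`). [cite: ONeill1983, Ch. 3, p. 85] -/
theorem gradSq_ne_zero_of_not_isMCriticalPt
    (G : ContMDiffRiemannianMetric (𝓡 2) ∞ (EuclideanSpace ℝ (Fin 2))
      (TangentSpace (𝓡 2) : N → Type _))
    {ρ : N → ℝ} {y : N} (hy : ¬ IsMCriticalPt (𝓡 2) ρ y) : (ofRiemannian G).gradSq ρ y ≠ 0 := by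
  set g := ofRiemannian G with hg
  have hgR : g.IsRiemannian := isRiemannian_ofRiemannian G
  have hne : grad g ρ y ≠ 0 := fun h0 ↦ hy ((grad_eq_zero_iff g ρ y).1 h0)
  have hval : g.gradSq ρ y = g.val y (grad g ρ y) (grad g ρ y) := by
    rw [val_grad]; rfl
  rw [hval]
  exact (hgR y _ hne).ne'

omit [T2Space N] [LocallyCompactSpace N] [SigmaCompactSpace N] [MeasurableSpace N]
  [BorelSpace N] in
/-- **The boundary integrand, pointwise.** Under the hypotheses of
`integral_comp_mul_scalarCurvature_eq`, at every point
`d(η ∘ ρ)(X) = −η'(ρ) · (Δρ − Hess ρ(∇ρ, ∇ρ)/|∇ρ|²)`: off the critical set this is the chain rule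
and `mvfderiv_normalizedAcceleration_grad_of_ne_zero`; at a critical point both sides vanish
because `η` is locally constant near the critical value (`η'(ρ p) = 0`). The factor
`Δρ − Hess ρ(n, n)` (`n = ∇ρ/|∇ρ|`) is `Hess ρ(T, T) = |∇ρ| · k` for a unit tangent `T` of the
level curve and its geodesic curvature `k` with respect to the normal `−n` pointing into the
sublevel set (`LevelCurveGeodesicCurvature.lean`,
`val_covariantDerivAlong_velocity_unitNormal_of_level`; Lee 2018, Ch. 9, p. 273).
[cite: LeeRiemannianManifolds2018, Ch. 9, p. 273] -/
theorem mvfderiv_comp_normalizedAcceleration_grad_eq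
    (G : ContMDiffRiemannianMetric (𝓡 2) ∞ (EuclideanSpace ℝ (Fin 2))
      (TangentSpace (𝓡 2) : N → Type _)) [(ofRiemannian G).HasLeviCivita]
    {ρ : N → ℝ} (hρ : ContMDiff (𝓡 2) 𝓘(ℝ, ℝ) ∞ ρ) {η : ℝ → ℝ} (hη : ContDiff ℝ ∞ η)
    (hcrit : ∀ p, IsMCriticalPt (𝓡 2) ρ p → η =ᶠ[𝓝 (ρ p)] fun _ ↦ η (ρ p)) (y : N) :
    mvfderiv (𝓡 2) (η ∘ ρ) y
        (normalizedAcceleration (ofRiemannian G) (grad (ofRiemannian G) ρ) y) =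
      -(deriv η (ρ y) * ((ofRiemannian G).dalembertian ρ y -
        (ofRiemannian G).hessian ρ y (grad (ofRiemannian G) ρ y) (grad (ofRiemannian G) ρ y) /
          (ofRiemannian G).gradSq ρ y)) := by
  set g := ofRiemannian G with hg
  have hηd : DifferentiableAt ℝ η (ρ y) := (hη.differentiable (by simp)).differentiableAt
  have hρd : MDifferentiableAt (𝓡 2) 𝓘(ℝ, ℝ) ρ y := (hρ y).mdifferentiableAt (by simp)
  rw [mvfderiv_real_comp hηd hρd]
  by_cases hyc : IsMCriticalPt (𝓡 2) ρ y
  · have hd : deriv η (ρ y) = 0 := by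
      rw [(hcrit y hyc).deriv_eq, deriv_const]
    rw [hd, zero_mul, zero_mul, neg_zero]
  · rw [mvfderiv_normalizedAcceleration_grad_of_ne_zero g ((hρ y).of_le (by norm_cast))
      (gradSq_ne_zero_of_not_isMCriticalPt G hyc)]
    ring

/-- **The weighted Gauss–Bonnet formula, level-curve form.** Under the hypotheses of
`integral_comp_mul_scalarCurvature_eq`:

  `∫_N η(ρ) S dμ = 4π Σ_{p ∈ C} (−1)^{ind_p ρ} η(ρ(p)) + 2 ∫_N η'(ρ) (Δρ − Hess ρ(∇ρ,∇ρ)/|∇ρ|²) dμ`,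

where `Δρ − Hess ρ(∇ρ, ∇ρ)/|∇ρ|² = |∇ρ| k`, `k` the geodesic curvature of the level curves of `ρ`
with respect to the normal pointing into the sublevel sets (the integrand vanishes at the critical
points, where `η'(ρ) = 0`). With `S = 2K` this is
`∫ η(ρ) K dA = 2π Σ (−1)^{ind} η(ρ(p)) + ∫ η'(ρ) k |∇ρ| dA`, the Gauss–Bonnet theorem with boundary
(Lee 2018, Thm. 9.3/9.7: `∫_D K dA + ∫_{∂D} k ds = 2π χ(D)`) integrated against `−η'` over the
family of sublevel sets `D_t = {ρ ≤ t}`. [cite: LeeRiemannianManifolds2018, Thm. 9.3 and Thm. 9.7] -/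
theorem integral_comp_mul_scalarCurvature_eq_sum_add_integral_deriv
    (G : ContMDiffRiemannianMetric (𝓡 2) ∞ (EuclideanSpace ℝ (Fin 2))
      (TangentSpace (𝓡 2) : N → Type _)) [(ofRiemannian G).HasLeviCivita]
    {ρ : N → ℝ} (hρ : IsMorse (𝓡 2) ρ) {η : ℝ → ℝ} (hη : ContDiff ℝ ∞ η)
    (hsupp : HasCompactSupport (η ∘ ρ))
    (hcrit : ∀ p, IsMCriticalPt (𝓡 2) ρ p → η =ᶠ[𝓝 (ρ p)] fun _ ↦ η (ρ p))
    (C : Finset N) (hC : ∀ p ∈ C, IsMCriticalPt (𝓡 2) ρ p)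
    (hC' : ∀ p, IsMCriticalPt (𝓡 2) ρ p → p ∈ tsupport (η ∘ ρ) → p ∈ C) :
    ∫ y, η (ρ y) * (ofRiemannian G).scalarCurvature y ∂riemannianMeasure G =
      4 * π * ∑ p ∈ C, (-1 : ℝ) ^ morseIndex (𝓡 2) ρ p * η (ρ p) +
        2 * ∫ y, deriv η (ρ y) * ((ofRiemannian G).dalembertian ρ y -
          (ofRiemannian G).hessian ρ y (grad (ofRiemannian G) ρ y) (grad (ofRiemannian G) ρ y) /
            (ofRiemannian G).gradSq ρ y) ∂riemannianMeasure G := by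
  rw [integral_comp_mul_scalarCurvature_eq G hρ hη hsupp hcrit C hC hC']
  have hpt := mvfderiv_comp_normalizedAcceleration_grad_eq G hρ.contMDiff hη hcrit
  rw [integral_congr_ae (ae_of_all _ hpt), integral_neg]
  ring

/-- **Gauss–Bonnet for a regular sublevel set, with a collar.** Let `(N, G)` be a Riemannian
surface (Hausdorff, locally compact, σ-compact, boundaryless, not necessarily compact), `ρ` a
Morse function with `{ρ ≤ b}` compact and no critical values in `[a, b]` (`a < b`), and
`η : ℝ → ℝ` smooth with `η = 1` on `(−∞, a]` and `η = 0` on `[b, ∞)`. Then, `C` being the (finite)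
set of critical points of `ρ` in `{ρ < a}`,

  `∫_N η(ρ) S dμ = 4π Σ_{p ∈ C} (−1)^{ind_p ρ} + 2 ∫_N η'(ρ) (Δρ − Hess ρ(∇ρ,∇ρ)/|∇ρ|²) dμ`,

the second integrand being supported in the collar `{a ≤ ρ ≤ b}`. The first term is `4π` times
the Morse count of the sublevel set `{ρ ≤ a}` (its Euler characteristic, Milnor 1963, §5), the
second is `−2 ×` the `(−η')`-average over `t ∈ [a, b]` of the total geodesic curvature
`∫_{ρ = t} k ds` of the level curves (coarea), i.e. this is Lee 2018, Thm. 9.3/9.7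
(`∫_D K dA + ∫_{∂D} k_g ds = 2πχ(D)`, `S = 2K`) for `D = {ρ ≤ t}` averaged over the collar — the
form in which the Gauss–Bonnet theorem with boundary is applied to the exhaustion `D_σ` of a
complete surface in Schoen–Yau 1979, §2, pp. 58–63 ((2.26)–(2.42), where `σ` is eventually chosen
in `[σ̄, 2σ̄]` by averaging). [cite: LeeRiemannianManifolds2018, Thm. 9.3 and Thm. 9.7]
[cite: SchoenYauPMT1979, §2, p. 58] -/
theorem integral_comp_mul_scalarCurvature_eq_of_sublevel
    (G : ContMDiffRiemannianMetric (𝓡 2) ∞ (EuclideanSpace ℝ (Fin 2))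
      (TangentSpace (𝓡 2) : N → Type _)) [(ofRiemannian G).HasLeviCivita]
    {ρ : N → ℝ} (hρ : IsMorse (𝓡 2) ρ) {a b : ℝ} (hcpt : IsCompact {y | ρ y ≤ b})
    (hreg : ∀ p, IsMCriticalPt (𝓡 2) ρ p → ρ p < a ∨ b < ρ p)
    {η : ℝ → ℝ} (hη : ContDiff ℝ ∞ η) (hηa : ∀ t ≤ a, η t = 1) (hηb : ∀ t, b ≤ t → η t = 0)
    (C : Finset N) (hC : ∀ p ∈ C, IsMCriticalPt (𝓡 2) ρ p ∧ ρ p < a)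
    (hC' : ∀ p, IsMCriticalPt (𝓡 2) ρ p → ρ p < a → p ∈ C) :
    ∫ y, η (ρ y) * (ofRiemannian G).scalarCurvature y ∂riemannianMeasure G =
      4 * π * ∑ p ∈ C, (-1 : ℝ) ^ morseIndex (𝓡 2) ρ p +
        2 * ∫ y, deriv η (ρ y) * ((ofRiemannian G).dalembertian ρ y -
          (ofRiemannian G).hessian ρ y (grad (ofRiemannian G) ρ y) (grad (ofRiemannian G) ρ y) /
            (ofRiemannian G).gradSq ρ y) ∂riemannianMeasure G := by
  have hρc : Continuous ρ := hρ.contMDiff.continuous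
  -- the weight has compact support inside `{ρ ≤ b}`
  have hts : tsupport (η ∘ ρ) ⊆ {y | ρ y ≤ b} := by
    refine closure_minimal (fun y hy ↦ ?_) (isClosed_le hρc continuous_const)
    rw [mem_support] at hy
    by_contra hyb
    simp only [mem_setOf_eq, not_le] at hyb
    exact hy (hηb _ hyb.le)
  have hsupp : HasCompactSupport (η ∘ ρ) := hcpt.of_isClosed_subset (isClosed_tsupport _) hts
  -- `η` is locally constant near every critical value
  have hcrit : ∀ p, IsMCriticalPt (𝓡 2) ρ p → η =ᶠ[𝓝 (ρ p)] fun _ ↦ η (ρ p) := by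
    intro p hp
    rcases hreg p hp with h | h
    · filter_upwards [Iio_mem_nhds h] with t ht
      rw [hηa t (le_of_lt ht), hηa (ρ p) h.le]
    · filter_upwards [Ioi_mem_nhds h] with t ht
      rw [hηb t (le_of_lt ht), hηb (ρ p) h.le]
  have hC₁ : ∀ p ∈ C, IsMCriticalPt (𝓡 2) ρ p := fun p hp ↦ (hC p hp).1
  have hC₂ : ∀ p, IsMCriticalPt (𝓡 2) ρ p → p ∈ tsupport (η ∘ ρ) → p ∈ C := by
    intro p hp hpt
    have hb : ρ p ≤ b := hts hpt
    rcases hreg p hp with h | h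
    · exact hC' p hp h
    · exact absurd hb (not_le.2 h)
  rw [integral_comp_mul_scalarCurvature_eq_sum_add_integral_deriv G hρ hη hsupp hcrit C hC₁ hC₂]
  congr 2
  refine Finset.sum_congr rfl fun p hp ↦ ?_
  rw [hηa (ρ p) (hC p hp).2.le, mul_one]

end Main

end Literature.Geometry.Riemannian

end
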